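/-
Origin: expansion seat `prover-pub-hodgecm-mc-sinst-1-g11-0`, handover #1271 2026-08-21T03:47Z md5 14aa2efe46dc (343 l.; NEW additive leaf, ns HodgeCM.Model.ThetaAdelicSide; SLOT 3 SEAM-AUT = the slot-1 text of #1265 on the conjugated line (hypotheses hη₃c, hη₃V, hη₃W : η₃(1, ũ) = 1 for rational ũ, h₁W): adelicLinePairEquiv_adelicInr_eq_cmCenter_three, chiThreeG_rationalToFinAdelic, continuous_chiThreeG(_val), twistCharW_bigCharThree_eq, adelicCharThree_cmCenter_symm_eq_one, twistCharW_bigCharThree_rationalToFinAdelic, cWThreeG_eq_torusScalar_threeG_finLineTorus (carch torusScalar_threeG), torusScalar_threeG_symm_eq_one_of (char₄_eq_one_of_rational at ratIsometry_conj), cWThreeG_∕psiThreeG_∕charThreeDictG_rationalToFinAdelic, hasRationalRestriction_charThreeDictG_one (hχinf : ∀ t, χ(♯(t,1_f))·torusScalar_threeG η₃ (u_t) = adelicCharThree η₃ (CMCenter (frameD V) u_t)) + _of_weight, continuous_torusScalar_threeG_val_of ∕ continuous_adelicCharThree_val (continuous_cmConjLineChar₁_of_signs), continuous_cWThreeG,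 continuous_twistCharW_bigCharThree, continuous_charThreeDictG, isLevelTrivial_charThreeDictG (UNCONDITIONAL), isAutChar_charThreeDictG + _of_weight; cert rc 0 ∕ 62 s; NAMES for audit: HodgeCM.Model.ThetaAdelicSide.charThreeDictG_rationalToFinAdelic · HodgeCM.Model.ThetaAdelicSide.isLevelTrivial_charThreeDictG · HodgeCM.Model.ThetaAdelicSide.isAutChar_charThreeDictG) (`HOME/mc/pub-hodgecm-mc-sinst-1-g11/stage70/HodgeCM/Model/AdelicThetaSlotThreeAutG.lean`, md5 14aa2efe46dc, 343 lines);
landed by the gen-30 packager (p-g30) in gate run 71 as `HodgeCM/Model/AdelicThetaSlotThreeAutG.lean` (verbatim).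
-/
/-
Copyright (c) 2026 the pub-hodgecm formalisation cell (harness21).  New file, not vendored.
Origin: session prover-pub-hodgecm-mc-sinst-1-g11-0 (unit pub-hodgecm-mc-sinst-1-g11, S-INSTANCE CONSTRUCTOR gen 11; SEAM-AUT for SLOT 3 over the
pin-agnostic G-datum: the slot-1 text of `Model/AdelicThetaSlotOneAutG` with `dW' c.D 1`, `hGR₂ hGR₃`, `cmConjLineChar₁`, carch's `torusScalar_threeG`
and the slot character `η₃` GENERIC; twisted record `splitLineThreeTwistedG` of `Model/AdelicThetaSlotThreeBridgeG`), 2026-08-21.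
Intended final place: `HodgeCM/Model/AdelicThetaSlotThreeAutG.lean` (NEW additive model-layer leaf; imports sinst-1 `Model/AdelicThetaSlotThreeBridgeG`
and #1260 `Model/AdelicThetaDistributionAut` (rational-point bookkeeping `ratInfPart ∕ ratInfOne`, `mk_finLineTorusIdeles_rationalToFinAdelic`); nothing
imports it; drop alone).
-/
import Summits.HodgeConjecture.HodgeCM.Model.AdelicThetaSlotThreeBridgeG
import Summits.HodgeConjecture.HodgeCM.Model.AdelicThetaDistributionAut_2

set_option autoImplicit false

/-!
# The slot-3 dictionary character `χ″₃(η₃, χ) = charThreeDictG η₃ χ` is automorphic ON THE WEIGHT SET modulo one archimedean identity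

For a GENERIC slot character `η₃` (hypotheses: `hη₃c` continuity, `hη₃V : η₃(γ, 1) = 1` on `U(diag frameD V)(L⁺)`, `hη₃W : η₃(1, ũ) = 1` for
rational `ũ`), on the twisted record `splitLineThreeTwistedG η₃` (`Model/AdelicThetaSlotThreeBridgeG`):
* § 1 `adelicLinePairEquiv_adelicInr_eq_cmCenter_three`, `chiThreeG_rationalToFinAdelic`, `continuous_chiThreeG`, **`twistCharW_bigCharThree_eq`** (`twistCharW ĉ₃(η₃) = adelicCharThree η₃ ∘ CMCenter ∘ finLineTorus`),
  `cWThreeG_eq_torusScalar_threeG_finLineTorus`, `torusScalar_threeG_symm_eq_one_of` (rational points, from `hη₃W` + [Weil1964, Thm 6]),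
  **`charThreeDictG_rationalToFinAdelic`**: `χ″₃(γ_f) = adelicCharThree η₃ ((t_γ,1_f) · 1_V)⁻¹ · χ(♯(t_γ,1_f)) · torusScalar_threeG η₃ (u_{t_γ})`;
* § 2 **`hasRationalRestriction_charThreeDictG_one`** under the ONE archimedean identity
  `hχinf : ∀ t, χ(♯(t,1_f)) · torusScalar_threeG η₃ (u_t) = adelicCharThree η₃ ((t,1_f) · 1_V)` (for `χ` on the slot's weight set = (Hw₃)
  `w₁ t · adelicCharThree η₃ (CMCenter (frameD V) u_t) = torusScalar_threeG η₃ (u_t)` — the archimedean centre acts trivially on the slot's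
  archimedean vector; theta-3's `hasCentralTypeAt_twistBy_iff`), `…_of_weight`;
* § 3 continuity ⇒ **`isLevelTrivial_charThreeDictG`** UNCONDITIONALLY (`hη₃c`, `h₁W`); **`isAutChar_charThreeDictG`** (+ `_of_weight`).
KERNEL only: 0 records, 0 `def … : Prop`, nothing cited as a hypothesis; `#print axioms` ⊆ {propext, Classical.choice, Quot.sound}.
-/

noncomputable section

open MulAction IsDedekindDomain NumberField.mixedEmbedding
open NumberField hiding relNormOneIdeles relNormOneRat probHaarRelNormOneQuot relNormOneInfUnits relNormOneInfToIdeles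
open scoped Matrix TensorProduct Classical SchwartzMap
open Literature.NumberTheory.Automorphic Literature.NumberTheory.Weil1964
open Literature.NumberTheory.GelbartRogawski1991 Literature.NumberTheory.GelbartRogawski1991.UnitaryDualPair
open Literature.RepresentationTheory (SeesawScalar.twist SeesawScalar.twist_apply)
open Literature.Geometry.ComplexHyperbolic.BallModel (U21 x₀)
open Literature.AlgebraicGeometry.ShimuraVarieties
open HodgeCM.Adelic HodgeCM.PerL34 HodgeCM.Model.ArchSideTerm HodgeCM.Model.ThetaDistFin
open Literature.NumberTheory.Automorphic.UnitaryGroup (cmAdelicOneEquivRelNormOne)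

namespace HodgeCM.Model
namespace ThetaAdelicSide

variable {L : CMField} {ι₁ : L →+* ℂ} (V : HermSpace3 L ι₁) (c : SeesawCtx L)
  (hGR : (cmSplittingDatum (L : Type) finProdFinEquiv (frameD V) (frameD_real V) (frameD_ne V) (dW c.D) (dW_real c.D)
    (dW_ne c.D)).CompatibleSplitting)
  (hGR₂ : (cmSplittingDatum (L : Type) (e₁) (frameD V) (frameD_real V) (frameD_ne V) (lineVec (L : Type) (dW' c.D 0))
    (fun _ => dW'_real c.D 0) (fun _ => dW'_ne c.D 0)).CompatibleSplitting)
  (hGR₃ : (cmSplittingDatum (L : Type) (e₁) (frameD V) (frameD_real V) (frameD_ne V) (lineVec (L : Type) (dW' c.D 1))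
    (fun _ => dW'_real c.D 1) (fun _ => dW'_ne c.D 1)).CompatibleSplitting)
  (η₃ : CMAdelic (L : Type) (frameD V) × CMAdelicOne (L : Type) →* ℂˣ)
  (hη₃c : Continuous fun p => ((η₃ p : ℂˣ) : ℂ))
  (hη₃V : ∀ v ∈ CMRat (L : Type) (frameD V), η₃ (v, 1) = 1)
  (hη₃W : ∀ t₀ ∈ relNormOneRat (↥(maximalRealSubfield L)) L, η₃ (1, (cmAdelicOneEquivRelNormOne (L : Type)).symm t₀) = 1)
  (h₁W : (∀ j, 0 < (ι₁ (dW c.D j)).re) ∨ ∀ j, (ι₁ (dW c.D j)).re < 0)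
  (χ : PontryaginDual (↥(relNormOneIdeles (↥(maximalRealSubfield L)) L) ⧸ relNormOneRat (↥(maximalRealSubfield L)) L))

/-! ## § 1. Values on rational points -/

/-- the line identification of #1255 for the line `⟨a₃⟩` takes `1 ⊗ w` to the CENTRE element `(det w) · 1_V`. -/
theorem adelicLinePairEquiv_adelicInr_eq_cmCenter_three (w : CMAdelic (L : Type) (lineVec (L : Type) (dW' c.D 1))) :
    LinePair.adelicLinePairEquiv (↥(maximalRealSubfield L)) (L : Type) (IsCMField.complexConj L) 3 (Matrix.diagonal (frameD V))
        (Matrix.diagonal (lineVec (L : Type) (dW' c.D 1))) (lineVec_dW'_one_ne c)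
        (UnitaryGroup.adelicInr (↥(maximalRealSubfield L)) (L : Type) (IsCMField.complexConj L) 3 1 (Matrix.diagonal (frameD V))
          (Matrix.diagonal (lineVec (L : Type) (dW' c.D 1))) w) =
      CMCenter (L : Type) (frameD V) (cmAdelicDet (L : Type) (lineVec (L : Type) (dW' c.D 1)) (fun _ => dW'_ne c.D 1) w) := by
  apply Subtype.ext
  apply Units.ext
  rw [LinePair.coe_adelicLinePairEquiv_adelicInr, UnitaryGroup.coe_adelicCenter, coe_cmAdelicDet, Matrix.GeneralLinearGroup.val_det_apply,
    Matrix.det_unique]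

/-- `chiThreeG χ (γ_f) = χ(♯(t_γ, 1_f))`. -/
theorem chiThreeG_rationalToFinAdelic
    (γ : ↥(UnitaryGroup.rational (↥(maximalRealSubfield L)) (L : Type) (IsCMField.complexConj L) 1
      (Matrix.diagonal (lineVec (L : Type) (dW' c.D 1))))) :
    chiThreeG c χ (UnitaryGroup.rationalToFinAdelic (↥(maximalRealSubfield L)) (L : Type) (IsCMField.complexConj L) 1
        (Matrix.diagonal (lineVec (L : Type) (dW' c.D 1))) γ) =
      Circle.toUnits (χ (QuotientGroup.mk
        (relNormOneInfToIdeles (↥(maximalRealSubfield L)) L (ratInfPart (L : Type) (dW' c.D 1) (dW'_ne c.D 1) γ)))) := by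
  rw [chiThreeG]
  simp only [MonoidHom.coe_comp, Function.comp_apply, QuotientGroup.mk'_apply, invMonoidHom_apply,
    mk_finLineTorusIdeles_rationalToFinAdelic, map_inv, inv_inv, MonoidHom.coe_coe]

/-- the coinvariant character of slot 3 has continuous values. -/
theorem continuous_chiThreeG_val : Continuous fun u : UfThree c.D => ((chiThreeG c χ u : ℂˣ) : ℂ) := by
  have hf : Continuous (finLineTorusIdeles (L : Type) (dW' c.D 1) (dW'_ne c.D 1)) :=
    (continuous_cmAdelicOneEquivRelNormOne (L : Type)).comp
      ((continuous_cmAdelicDet (L : Type) (lineVec (L : Type) (dW' c.D 1)) fun _ => dW'_ne c.D 1).comp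
        (UnitaryGroup.continuous_finAdelicToAdelic _ _ _ _ _))
  show Continuous fun u : UfThree c.D =>
    ((((χ : ↥(relNormOneIdeles (↥(maximalRealSubfield L)) L) ⧸ relNormOneRat (↥(maximalRealSubfield L)) L →* Circle)
      (QuotientGroup.mk (finLineTorusIdeles (L : Type) (dW' c.D 1) (dW'_ne c.D 1) u)))⁻¹ : Circle) : ℂ)
  exact continuous_subtype_val.comp (((map_continuous χ).comp (QuotientGroup.continuous_mk.comp hf)).inv)

/-- the coinvariant character of slot 3 is continuous (into `ℂˣ`). -/
theorem continuous_chiThreeG : Continuous (chiThreeG c χ) :=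
  (chiThreeG c χ).continuous_of_continuous_units_val (continuous_chiThreeG_val c χ)

/-- **`twistCharW ĉ₃(η₃) u = adelicCharThree η₃ ((det (1_∞, u)) · 1_V)`**. -/
theorem twistCharW_bigCharThree_eq (u : UfThree c.D) :
    HodgeCM.WeilCoinv.twistCharW (↥(maximalRealSubfield L)) (L : Type) (IsCMField.complexConj L) 3 1
        (Matrix.diagonal (frameD V)) (splitLineThreeG V c hGR₃).JW (bigCharThree V c hGR hGR₂ hGR₃ η₃) u =
      adelicCharThree V c hGR hGR₂ hGR₃ η₃ (CMCenter (L : Type) (frameD V) (finLineTorus (L : Type) (dW' c.D 1) (dW'_ne c.D 1) u)) := by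
  show HodgeCM.WeilCoinv.twistCharW (↥(maximalRealSubfield L)) (L : Type) (IsCMField.complexConj L) 3 1
      (Matrix.diagonal (frameD V)) (Matrix.diagonal (lineVec (L : Type) (dW' c.D 1))) (bigCharThree V c hGR hGR₂ hGR₃ η₃) u = _
  rw [bigCharThree, LinePair.twistCharW_bigCharOfV_apply, adelicLinePairEquiv_adelicInr_eq_cmCenter_three, finLineTorus_apply]

include hη₃V in
/-- `adelicCharThree η₃` is trivial on the RATIONAL centre. -/
theorem adelicCharThree_cmCenter_symm_eq_one {t₀ : ↥(relNormOneIdeles (↥(maximalRealSubfield L)) L)}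
    (ht₀ : t₀ ∈ relNormOneRat (↥(maximalRealSubfield L)) L) :
    adelicCharThree V c hGR hGR₂ hGR₃ η₃ (CMCenter (L : Type) (frameD V) ((cmAdelicOneEquivRelNormOne (L : Type)).symm t₀)) = 1 :=
  adelicCharThree_eq_one_of_rat V c hGR hGR₂ hGR₃ η₃ hη₃V
    (UnitaryGroup.cm_adelicCenter_symm_mem_range_toAdelic (L : Type) 3 (Matrix.diagonal (frameD V)) t₀ ht₀)

include hη₃V in
/-- **`twistCharW ĉ₃(η₃) (γ_f) = adelicCharThree η₃ ((t_γ, 1_f) · 1_V)⁻¹`** on a rational point. -/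
theorem twistCharW_bigCharThree_rationalToFinAdelic
    (γ : ↥(UnitaryGroup.rational (↥(maximalRealSubfield L)) (L : Type) (IsCMField.complexConj L) 1
      (Matrix.diagonal (lineVec (L : Type) (dW' c.D 1))))) :
    HodgeCM.WeilCoinv.twistCharW (↥(maximalRealSubfield L)) (L : Type) (IsCMField.complexConj L) 3 1
        (Matrix.diagonal (frameD V)) (splitLineThreeG V c hGR₃).JW (bigCharThree V c hGR hGR₂ hGR₃ η₃)
        (UnitaryGroup.rationalToFinAdelic (↥(maximalRealSubfield L)) (L : Type) (IsCMField.complexConj L) 1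
          (Matrix.diagonal (lineVec (L : Type) (dW' c.D 1))) γ) =
      (adelicCharThree V c hGR hGR₂ hGR₃ η₃ (CMCenter (L : Type) (frameD V) (ratInfOne (L : Type) (dW' c.D 1) (dW'_ne c.D 1) γ)))⁻¹ := by
  rw [twistCharW_bigCharThree_eq, finLineTorus_rationalToFinAdelic, map_mul, map_inv, map_mul, map_inv,
    adelicCharThree_cmCenter_symm_eq_one V c hGR hGR₂ hGR₃ η₃ hη₃V (ratDetIdele_mem_relNormOneRat (L : Type) (dW' c.D 1) (dW'_ne c.D 1) γ),
    mul_one]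
  rfl

/-- `cWThreeG η₃ = torusScalar_threeG η₃ ∘ finLineTorus`. -/
theorem cWThreeG_eq_torusScalar_threeG_finLineTorus (u : UfThree c.D) :
    cWThreeG V c hGR hGR₂ hGR₃ η₃ u =
      torusScalar_threeG V c.D hGR hGR₂ hGR₃ η₃ (finLineTorus (L : Type) (dW' c.D 1) (dW'_ne c.D 1) u) := by
  rw [cWThreeG_apply, finCharThree_apply, finPairDThree_apply, map_one, map_one, torusScalar_three_applyG, cmCenter_finLineTorus]
  rfl

include hη₃W in
/-- the torus scalar of line 3 at `η₃` is trivial on RATIONAL points (`hη₃W` + [Weil1964, Thm 6] `char₄_eq_one_of_rational`). -/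
theorem torusScalar_threeG_symm_eq_one_of {t₀ : ↥(relNormOneIdeles (↥(maximalRealSubfield L)) L)}
    (ht₀ : t₀ ∈ relNormOneRat (↥(maximalRealSubfield L)) L) :
    torusScalar_threeG V c.D hGR hGR₂ hGR₃ η₃ ((cmAdelicOneEquivRelNormOne (L : Type)).symm t₀) = 1 := by
  obtain ⟨γ₀, hγ₀⟩ := UnitaryGroup.cm_adelicCenter_symm_mem_range_toAdelic (L : Type) 1
    (Matrix.diagonal (lineVec (L : Type) (dW' c.D 1))) t₀ ht₀
  have hχ1 : cmConjLineChar₁ (L : Type) finProdFinEquiv e₁ (frameD V) (frameD_real V) (frameD_ne V) (dW c.D) (dW_real c.D) (dW_ne c.D)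
        (dW' c.D) (dW'_real c.D) (dW'_ne c.D) c.D.isoGL (isoGL_hg₀ c.D) hGR hGR₂ hGR₃ (1, CMCenter (L : Type) (lineVec (L : Type) (dW' c.D 1)) ((cmAdelicOneEquivRelNormOne (L : Type)).symm t₀)) = 1 := by
    rw [cmConjLineChar₁]
    simp only [MonoidHom.coe_comp, Function.comp_apply, MonoidHom.coe_snd]
    apply char₄_eq_one_of_rational
    · exact ratIsometry_conj (L : Type) (dW c.D) (dW' c.D) c.D.isoGL (isoGL_hg₀ c.D)
    · exact ⟨γ₀, hγ₀⟩
  rw [torusScalar_three_applyG, hη₃W t₀ ht₀, hχ1, mul_one]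

include hη₃W in
/-- `cWThreeG η₃ (γ_f) = torusScalar_threeG η₃ (u_{t_γ})⁻¹`. -/
theorem cWThreeG_rationalToFinAdelic
    (γ : ↥(UnitaryGroup.rational (↥(maximalRealSubfield L)) (L : Type) (IsCMField.complexConj L) 1
      (Matrix.diagonal (lineVec (L : Type) (dW' c.D 1))))) :
    cWThreeG V c hGR hGR₂ hGR₃ η₃ (UnitaryGroup.rationalToFinAdelic (↥(maximalRealSubfield L)) (L : Type) (IsCMField.complexConj L) 1
        (Matrix.diagonal (lineVec (L : Type) (dW' c.D 1))) γ) =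
      (torusScalar_threeG V c.D hGR hGR₂ hGR₃ η₃ (ratInfOne (L : Type) (dW' c.D 1) (dW'_ne c.D 1) γ))⁻¹ := by
  rw [cWThreeG_eq_torusScalar_threeG_finLineTorus, finLineTorus_rationalToFinAdelic, map_mul, map_inv,
    torusScalar_threeG_symm_eq_one_of V c hGR hGR₂ hGR₃ η₃ hη₃W (ratDetIdele_mem_relNormOneRat (L : Type) (dW' c.D 1) (dW'_ne c.D 1) γ),
    mul_one]
  rfl

include hη₃W in
/-- `ψ₃(η₃, χ)(γ_f) = χ(♯(t_γ, 1_f)) · torusScalar_threeG η₃ (u_{t_γ})`. -/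
theorem psiThreeG_rationalToFinAdelic
    (γ : ↥(UnitaryGroup.rational (↥(maximalRealSubfield L)) (L : Type) (IsCMField.complexConj L) 1
      (Matrix.diagonal (lineVec (L : Type) (dW' c.D 1))))) :
    psiThreeG V c hGR hGR₂ hGR₃ η₃ χ (UnitaryGroup.rationalToFinAdelic (↥(maximalRealSubfield L)) (L : Type) (IsCMField.complexConj L) 1
        (Matrix.diagonal (lineVec (L : Type) (dW' c.D 1))) γ) =
      Circle.toUnits (χ (QuotientGroup.mk
          (relNormOneInfToIdeles (↥(maximalRealSubfield L)) L (ratInfPart (L : Type) (dW' c.D 1) (dW'_ne c.D 1) γ)))) *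
        torusScalar_threeG V c.D hGR hGR₂ hGR₃ η₃ (ratInfOne (L : Type) (dW' c.D 1) (dW'_ne c.D 1) γ) := by
  rw [psiThreeG, MonoidHom.mul_apply, MonoidHom.inv_apply, chiThreeG_rationalToFinAdelic, cWThreeG_rationalToFinAdelic V c hGR hGR₂ hGR₃ η₃ hη₃W,
    inv_inv]

include hη₃V hη₃W in
/-- **`χ″₃(γ_f) = adelicCharThree η₃ ((t_γ,1_f) · 1_V)⁻¹ · (χ(♯(t_γ, 1_f)) · torusScalar_threeG η₃ (u_{t_γ}))`** — an ARCHIMEDEAN quantity. -/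
theorem charThreeDictG_rationalToFinAdelic
    (γ : ↥(UnitaryGroup.rational (↥(maximalRealSubfield L)) (L : Type) (IsCMField.complexConj L) 1
      (Matrix.diagonal (lineVec (L : Type) (dW' c.D 1))))) :
    charThreeDictG V c hGR hGR₂ hGR₃ η₃ χ (UnitaryGroup.rationalToFinAdelic (↥(maximalRealSubfield L)) (L : Type)
        (IsCMField.complexConj L) 1 (Matrix.diagonal (lineVec (L : Type) (dW' c.D 1))) γ) =
      (adelicCharThree V c hGR hGR₂ hGR₃ η₃ (CMCenter (L : Type) (frameD V) (ratInfOne (L : Type) (dW' c.D 1) (dW'_ne c.D 1) γ)))⁻¹ *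
        (Circle.toUnits (χ (QuotientGroup.mk
            (relNormOneInfToIdeles (↥(maximalRealSubfield L)) L (ratInfPart (L : Type) (dW' c.D 1) (dW'_ne c.D 1) γ)))) *
          torusScalar_threeG V c.D hGR hGR₂ hGR₃ η₃ (ratInfOne (L : Type) (dW' c.D 1) (dW'_ne c.D 1) γ)) := by
  rw [charThreeDictG, MonoidHom.mul_apply, twistCharW_bigCharThree_rationalToFinAdelic V c hGR hGR₂ hGR₃ η₃ hη₃V]
  exact congrArg _ (psiThreeG_rationalToFinAdelic V c hGR hGR₂ hGR₃ η₃ hη₃W χ γ)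

/-! ## § 2. Rational triviality from ONE archimedean identity -/

include hη₃V hη₃W in
/-- **`χ″₃` IS TRIVIAL ON `U(⟨a₃⟩)(L⁺)`** as soon as `χ(♯(t,1_f)) · torusScalar_threeG η₃ (u_t) = adelicCharThree η₃ ((t,1_f) · 1_V)` on the
archimedean torus. -/
theorem hasRationalRestriction_charThreeDictG_one
    (hχinf : ∀ t : ↥(relNormOneInfUnits (↥(maximalRealSubfield L)) L),
      ((χ (QuotientGroup.mk (relNormOneInfToIdeles (↥(maximalRealSubfield L)) L t)) : Circle) : ℂ) *
          ((torusScalar_threeG V c.D hGR hGR₂ hGR₃ η₃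
            ((cmAdelicOneEquivRelNormOne (L : Type)).symm (relNormOneInfToIdeles (↥(maximalRealSubfield L)) L t)) : ℂˣ) : ℂ) =
        ((adelicCharThree V c hGR hGR₂ hGR₃ η₃ (CMCenter (L : Type) (frameD V)
            ((cmAdelicOneEquivRelNormOne (L : Type)).symm (relNormOneInfToIdeles (↥(maximalRealSubfield L)) L t))) : ℂˣ) : ℂ)) :
    (splitLineThreeTwistedG V c hGR hGR₂ hGR₃ η₃ hη₃V).HasRationalRestriction (charThreeDictG V c hGR hGR₂ hGR₃ η₃ χ) 1 := by
  rw [SplitLine.hasRationalRestriction_iff]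
  intro γ
  have h := charThreeDictG_rationalToFinAdelic V c hGR hGR₂ hGR₃ η₃ hη₃V hη₃W χ γ
  have hne : adelicCharThree V c hGR hGR₂ hGR₃ η₃ (CMCenter (L : Type) (frameD V) (ratInfOne (L : Type) (dW' c.D 1) (dW'_ne c.D 1) γ)) *
      1 = adelicCharThree V c hGR hGR₂ hGR₃ η₃ (CMCenter (L : Type) (frameD V) (ratInfOne (L : Type) (dW' c.D 1) (dW'_ne c.D 1) γ)) *
        ((adelicCharThree V c hGR hGR₂ hGR₃ η₃ (CMCenter (L : Type) (frameD V) (ratInfOne (L : Type) (dW' c.D 1) (dW'_ne c.D 1) γ)))⁻¹ *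
          (Circle.toUnits (χ (QuotientGroup.mk
              (relNormOneInfToIdeles (↥(maximalRealSubfield L)) L (ratInfPart (L : Type) (dW' c.D 1) (dW'_ne c.D 1) γ)))) *
            torusScalar_threeG V c.D hGR hGR₂ hGR₃ η₃ (ratInfOne (L : Type) (dW' c.D 1) (dW'_ne c.D 1) γ))) := by
    rw [mul_one, mul_inv_cancel_left]
    apply Units.ext
    rw [Units.val_mul]
    exact (hχinf _).symm
  rw [MonoidHom.one_apply]
  exact h.trans (mul_left_cancel hne).symm

include hη₃V hη₃W in
/-- the same from the WEIGHT identity and (Hw₃) `w t · adelicCharThree η₃ ((t,1_f) · 1_V) = torusScalar_threeG η₃ (u_t)`. -/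
theorem hasRationalRestriction_charThreeDictG_one_of_weight (w : ↥(relNormOneInfUnits (↥(maximalRealSubfield L)) L) → ℂ)
    (hχw : ∀ t : ↥(relNormOneInfUnits (↥(maximalRealSubfield L)) L),
      ((χ (QuotientGroup.mk (relNormOneInfToIdeles (↥(maximalRealSubfield L)) L t)) : Circle) : ℂ) * w t = 1)
    (hw : ∀ t : ↥(relNormOneInfUnits (↥(maximalRealSubfield L)) L),
      w t * ((adelicCharThree V c hGR hGR₂ hGR₃ η₃ (CMCenter (L : Type) (frameD V)
            ((cmAdelicOneEquivRelNormOne (L : Type)).symm (relNormOneInfToIdeles (↥(maximalRealSubfield L)) L t))) : ℂˣ) : ℂ) =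
        ((torusScalar_threeG V c.D hGR hGR₂ hGR₃ η₃
            ((cmAdelicOneEquivRelNormOne (L : Type)).symm (relNormOneInfToIdeles (↥(maximalRealSubfield L)) L t)) : ℂˣ) : ℂ)) :
    (splitLineThreeTwistedG V c hGR hGR₂ hGR₃ η₃ hη₃V).HasRationalRestriction (charThreeDictG V c hGR hGR₂ hGR₃ η₃ χ) 1 := by
  refine hasRationalRestriction_charThreeDictG_one V c hGR hGR₂ hGR₃ η₃ hη₃V hη₃W χ fun t => ?_
  rw [← hw t, ← mul_assoc, hχw t, one_mul]

/-! ## § 3. Level triviality (continuity) and `IsAutChar` -/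

include hη₃c h₁W in
/-- carch's torus scalar of line 3 at `η₃` has continuous values. -/
theorem continuous_torusScalar_threeG_val_of :
    Continuous fun u : CMAdelicOne (L : Type) => ((torusScalar_threeG V c.D hGR hGR₂ hGR₃ η₃ u : ℂˣ) : ℂ) := by
  have h1 : Continuous fun u : CMAdelicOne (L : Type) => ((η₃ (1, u) : ℂˣ) : ℂ) := hη₃c.comp (continuous_const.prodMk continuous_id)
  have h2 : Continuous fun u : CMAdelicOne (L : Type) =>
      ((cmConjLineChar₁ (L : Type) finProdFinEquiv e₁ (frameD V) (frameD_real V) (frameD_ne V) (dW c.D) (dW_real c.D) (dW_ne c.D)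
        (dW' c.D) (dW'_real c.D) (dW'_ne c.D) c.D.isoGL (isoGL_hg₀ c.D) hGR hGR₂ hGR₃ (1, CMCenter (L : Type) (lineVec (L : Type) (dW' c.D 1)) u) : ℂˣ) : ℂ) :=
    (continuous_cmConjLineChar₁_of_signs (L : Type) finProdFinEquiv e₁ (frameD V) (frameD_real V) (frameD_ne V) (dW c.D) (dW_real c.D)
        (dW_ne c.D) hGR (dW' c.D) (dW'_real c.D) (dW'_ne c.D) c.D.isoGL (isoGL_hg₀ c.D) hGR₂ hGR₃ ι₁ (frameD_sign_ι₁' V) h₁W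
        (frameD_sign_of_ne V)).comp
      (continuous_const.prodMk (continuous_adelicCenter _ _ _ _ _))
  simp only [torusScalar_three_applyG, Units.val_mul]
  exact h1.mul h2

include hη₃c h₁W in
/-- the adelic `V`-character `adelicCharThree η₃` has continuous values. -/
theorem continuous_adelicCharThree_val :
    Continuous fun v : CMAdelic (L : Type) (frameD V) => ((adelicCharThree V c hGR hGR₂ hGR₃ η₃ v : ℂˣ) : ℂ) := by
  have h1 : Continuous fun v : CMAdelic (L : Type) (frameD V) => ((η₃ (v, 1) : ℂˣ) : ℂ) := hη₃c.comp (continuous_id.prodMk continuous_const)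
  have h2 : Continuous fun v : CMAdelic (L : Type) (frameD V) =>
      ((cmConjLineChar₁ (L : Type) finProdFinEquiv e₁ (frameD V) (frameD_real V) (frameD_ne V) (dW c.D) (dW_real c.D) (dW_ne c.D)
        (dW' c.D) (dW'_real c.D) (dW'_ne c.D) c.D.isoGL (isoGL_hg₀ c.D) hGR hGR₂ hGR₃ (v, 1) : ℂˣ) : ℂ) :=
    (continuous_cmConjLineChar₁_of_signs (L : Type) finProdFinEquiv e₁ (frameD V) (frameD_real V) (frameD_ne V) (dW c.D) (dW_real c.D)
        (dW_ne c.D) hGR (dW' c.D) (dW'_real c.D) (dW'_ne c.D) c.D.isoGL (isoGL_hg₀ c.D) hGR₂ hGR₃ ι₁ (frameD_sign_ι₁' V) h₁W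
        (frameD_sign_of_ne V)).comp
      (continuous_id.prodMk continuous_const)
  simp only [adelicCharThree_apply, Units.val_mul]
  exact h1.mul h2

include hη₃c h₁W in
/-- `cWThreeG η₃` is continuous (into `ℂˣ`). -/
theorem continuous_cWThreeG : Continuous (cWThreeG V c hGR hGR₂ hGR₃ η₃) := by
  apply (cWThreeG V c hGR hGR₂ hGR₃ η₃).continuous_of_continuous_units_val
  have hf : Continuous (finLineTorus (L : Type) (dW' c.D 1) (dW'_ne c.D 1)) :=
    (continuous_cmAdelicDet (L : Type) (lineVec (L : Type) (dW' c.D 1)) fun _ => dW'_ne c.D 1).comp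
      (UnitaryGroup.continuous_finAdelicToAdelic _ _ _ _ _)
  simp only [cWThreeG_eq_torusScalar_threeG_finLineTorus]
  exact (continuous_torusScalar_threeG_val_of V c hGR hGR₂ hGR₃ η₃ hη₃c h₁W).comp hf

include hη₃c h₁W in
/-- the `W`-part of `ĉ₃(η₃)` is continuous (into `ℂˣ`). -/
theorem continuous_twistCharW_bigCharThree :
    Continuous (HodgeCM.WeilCoinv.twistCharW (↥(maximalRealSubfield L)) (L : Type) (IsCMField.complexConj L) 3 1
      (Matrix.diagonal (frameD V)) (splitLineThreeG V c hGR₃).JW (bigCharThree V c hGR hGR₂ hGR₃ η₃)) := by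
  apply MonoidHom.continuous_of_continuous_units_val
  have hf : Continuous (finLineTorus (L : Type) (dW' c.D 1) (dW'_ne c.D 1)) :=
    (continuous_cmAdelicDet (L : Type) (lineVec (L : Type) (dW' c.D 1)) fun _ => dW'_ne c.D 1).comp
      (UnitaryGroup.continuous_finAdelicToAdelic _ _ _ _ _)
  simp only [twistCharW_bigCharThree_eq]
  exact (continuous_adelicCharThree_val V c hGR hGR₂ hGR₃ η₃ hη₃c h₁W).comp ((continuous_adelicCenter _ _ _ _ _).comp hf)

include hη₃c h₁W in
/-- `χ″₃` is continuous (into `ℂˣ`). -/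
theorem continuous_charThreeDictG : Continuous (charThreeDictG V c hGR hGR₂ hGR₃ η₃ χ) := by
  show Continuous fun u =>
    HodgeCM.WeilCoinv.twistCharW (↥(maximalRealSubfield L)) (L : Type) (IsCMField.complexConj L) 3 1
        (Matrix.diagonal (frameD V)) (splitLineThreeG V c hGR₃).JW (bigCharThree V c hGR hGR₂ hGR₃ η₃) u *
      (chiThreeG c χ u * (cWThreeG V c hGR hGR₂ hGR₃ η₃ u)⁻¹)
  exact (continuous_twistCharW_bigCharThree V c hGR hGR₂ hGR₃ η₃ hη₃c h₁W).mul
    ((continuous_chiThreeG c χ).mul (continuous_cWThreeG V c hGR hGR₂ hGR₃ η₃ hη₃c h₁W).inv)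

include hη₃c h₁W in
/-- **`χ″₃` IS LEVEL-TRIVIAL** on the twisted slot-3 record — unconditionally. -/
theorem isLevelTrivial_charThreeDictG :
    (splitLineThreeTwistedG V c hGR hGR₂ hGR₃ η₃ hη₃V).IsLevelTrivial (charThreeDictG V c hGR hGR₂ hGR₃ η₃ χ) := by
  obtain ⟨n₀, hn₀, h⟩ := UnitaryGroup.exists_nat_forall_dvd_finCongruenceLevel_le_ker (charThreeDictG V c hGR hGR₂ hGR₃ η₃ χ)
    (continuous_charThreeDictG V c hGR hGR₂ hGR₃ η₃ hη₃c h₁W χ).continuousAt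
  exact ⟨n₀, hn₀, fun k hk => h n₀ hn₀ (dvd_refl _) k hk⟩

include hη₃c hη₃W h₁W in
/-- **`χ″₃ = charThreeDictG η₃ χ` IS A `GoodChar` OF THE TWISTED SLOT-3 RECORD** (`IsAutChar`) under the ONE archimedean identity — binder-2's
socket hypothesis `hχ` for slot 3, at every pin. -/
theorem isAutChar_charThreeDictG
    (hχinf : ∀ t : ↥(relNormOneInfUnits (↥(maximalRealSubfield L)) L),
      ((χ (QuotientGroup.mk (relNormOneInfToIdeles (↥(maximalRealSubfield L)) L t)) : Circle) : ℂ) *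
          ((torusScalar_threeG V c.D hGR hGR₂ hGR₃ η₃
            ((cmAdelicOneEquivRelNormOne (L : Type)).symm (relNormOneInfToIdeles (↥(maximalRealSubfield L)) L t)) : ℂˣ) : ℂ) =
        ((adelicCharThree V c hGR hGR₂ hGR₃ η₃ (CMCenter (L : Type) (frameD V)
            ((cmAdelicOneEquivRelNormOne (L : Type)).symm (relNormOneInfToIdeles (↥(maximalRealSubfield L)) L t))) : ℂˣ) : ℂ)) :
    (splitLineThreeTwistedG V c hGR hGR₂ hGR₃ η₃ hη₃V).IsAutChar (charThreeDictG V c hGR hGR₂ hGR₃ η₃ χ) :=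
  ⟨isLevelTrivial_charThreeDictG V c hGR hGR₂ hGR₃ η₃ hη₃c hη₃V h₁W χ,
    hasRationalRestriction_charThreeDictG_one V c hGR hGR₂ hGR₃ η₃ hη₃V hη₃W χ hχinf⟩

include hη₃c hη₃W h₁W in
/-- the same from the WEIGHT identity and (Hw₃). -/
theorem isAutChar_charThreeDictG_of_weight (w : ↥(relNormOneInfUnits (↥(maximalRealSubfield L)) L) → ℂ)
    (hχw : ∀ t : ↥(relNormOneInfUnits (↥(maximalRealSubfield L)) L),
      ((χ (QuotientGroup.mk (relNormOneInfToIdeles (↥(maximalRealSubfield L)) L t)) : Circle) : ℂ) * w t = 1)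
    (hw : ∀ t : ↥(relNormOneInfUnits (↥(maximalRealSubfield L)) L),
      w t * ((adelicCharThree V c hGR hGR₂ hGR₃ η₃ (CMCenter (L : Type) (frameD V)
            ((cmAdelicOneEquivRelNormOne (L : Type)).symm (relNormOneInfToIdeles (↥(maximalRealSubfield L)) L t))) : ℂˣ) : ℂ) =
        ((torusScalar_threeG V c.D hGR hGR₂ hGR₃ η₃
            ((cmAdelicOneEquivRelNormOne (L : Type)).symm (relNormOneInfToIdeles (↥(maximalRealSubfield L)) L t)) : ℂˣ) : ℂ)) :
    (splitLineThreeTwistedG V c hGR hGR₂ hGR₃ η₃ hη₃V).IsAutChar (charThreeDictG V c hGR hGR₂ hGR₃ η₃ χ) :=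
  ⟨isLevelTrivial_charThreeDictG V c hGR hGR₂ hGR₃ η₃ hη₃c hη₃V h₁W χ,
    hasRationalRestriction_charThreeDictG_one_of_weight V c hGR hGR₂ hGR₃ η₃ hη₃V hη₃W χ w hχw hw⟩

end ThetaAdelicSide
end HodgeCM.Model

end
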